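import Summits.AtomisticToContinuum.Crystallization.Theses.SpectralChargeLedger
import Summits.AtomisticToContinuum.Crystallization.Theorems.OneMultiplierPricing.Negative.BarlowShellDilation
import Summits.AtomisticToContinuum.Crystallization.Theorems.OneMultiplierPricing.Negative.Virial

/-!
# Negative knowledge for crux `SpectralChargeLedger.SummedShellPricing` (stmt-AtomisticToContinuum-17044), I:
# the pricing clause, and its `O(τ²)` TIGHTNESS

Refuter file (`--supports stmt-AtomisticToContinuum-17044`; cdisprove seat, cycle 1; mirrors §0–§2
of the crux work file `Cruxes/SummedShellPricing/Disproof.lean`).  Nothing here asserts the crux.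
No definitions: the crux's `τ`-goodness predicate and its inner pricing clause are abbreviated by
the scoped NOTATIONS `Good⟪a₀, h₀, y, i, τ⟫` and `PC⟪δ, a₀, h₀, τ, κ⟫` (pure syntax, verbatim the
route decl), so that `SummedShellPricing ↔ ∀ δ > 0, ∃ cell, ∀ τ ∈ (0,1], ∃ κ > 0, PC⟪δ, a₀, h₀, τ, κ⟫`
holds by `Iff.rfl` (`summedShellPricing_iff`).  All `[folklore]`, from tree facts
(`LennardJonesGroundStatesExist_holds`, `crysEnergyLimit`, the virial bound
`interactionEnergy_dilate_le`, the shell enumeration `norm_le_of_mem_barlowStacking` and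
`dilation_defect` of `Theorems/OneMultiplierPricing/Negative/`).

* §0  `summedShellPricing_iff`; monotonicity of the clause in `τ`, `κ`, `δ`.
* §1  reference shells: norms `≤ ρ = max a₀ √(a₀²/3+h₀²) ≤ 1.01 a₀`, `ρ` and `a₀` attained in both;
      `eStar_le_neg : e⋆ ≤ −1/24`.
* §2  **`kappa_le_of_pricingClause`** — if Lennard-Jones ground states are `δ`-separated, a price
      `κ` admissible at a cell of the box and tolerance `0 < τ ≤ 1/20` satisfies
      `κ ≤ 324·(−e⋆)·(τ/a₀)²`.  Witness: the ground states `x^N` (excess `o(N)`) and their dilates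
      `(1 + 3τ/ρ)·x^N` (excess `≤ o(N) + 36 s²·|𝓔(N)|`), between which EVERY site is `τ`-bad
      (`not_good_dilate_of_good`).  So `κ(τ) → 0` quadratically is forced; parts II–III draw the
      consequences (no uniform / linear price, `τ = 0` false, the cell is pinned, load-bearing
      hypotheses).
-/

noncomputable section

namespace Summit.AtomisticToContinuum.Crystallization.Theorems.SummedShellPricing.Negative

open scoped BigOperators
open Literature.MathematicalPhysics.StatisticalMechanics
open Summit.AtomisticToContinuum.Crystallization.Theorems.ChargedEnergyGapNegative
  (E3 eStar card_mul_eStar_le crysEnergyLimit groundStateEnergy_nonpos)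
open Summit.AtomisticToContinuum.Crystallization.Theorems.OneMultiplierPricing.Negative.BarlowShellDilation
open Summit.AtomisticToContinuum.Crystallization.Theorems.OneMultiplierPricing.Negative.Virial
open Summit.AtomisticToContinuum.Crystallization.Theses.SpectralChargeLedger (SummedShellPricing)

/-! ## §0 The crux, parametrised by notation -/

set_option quotPrecheck false in
/-- `Good⟪a₀, h₀, y, i, τ⟫` — the crux's `τ`-goodness of site `i` of `y` at cell `(a₀, h₀)`: the
punctured open `13/10·a₀`-shell is `τ`-matched, after a linear isometry and bijectively, to the
12-shell of `hcpStacking a₀ h₀` or of `fccStacking a₀ h₀` (SYNTAX ONLY, verbatim the route decl). -/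
scoped notation "Good⟪" a₀ ", " h₀ ", " y ", " i ", " τ "⟫" =>
  (∃ A : EuclideanSpace ℝ (Fin 3) →ₗᵢ[ℝ] EuclideanSpace ℝ (Fin 3),
    (∃ e : ↥{z : EuclideanSpace ℝ (Fin 3) | z ∈ Set.range y ∧ z ≠ y i ∧ dist z (y i) < 13 / 10 * a₀} ≃
        ↥{p : EuclideanSpace ℝ (Fin 3) | p ∈ hcpStacking a₀ h₀ ∧ p ≠ 0 ∧ ‖p‖ < 13 / 10 * a₀},
      ∀ t : ↥{z : EuclideanSpace ℝ (Fin 3) | z ∈ Set.range y ∧ z ≠ y i ∧ dist z (y i) < 13 / 10 * a₀},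
        dist ((t : EuclideanSpace ℝ (Fin 3)) - y i)
          (A ((e t : ↥{p : EuclideanSpace ℝ (Fin 3) | p ∈ hcpStacking a₀ h₀ ∧ p ≠ 0 ∧ ‖p‖ < 13 / 10 * a₀}) :
            EuclideanSpace ℝ (Fin 3))) ≤ τ) ∨
    (∃ e : ↥{z : EuclideanSpace ℝ (Fin 3) | z ∈ Set.range y ∧ z ≠ y i ∧ dist z (y i) < 13 / 10 * a₀} ≃
        ↥{p : EuclideanSpace ℝ (Fin 3) | p ∈ fccStacking a₀ h₀ ∧ p ≠ 0 ∧ ‖p‖ < 13 / 10 * a₀},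
      ∀ t : ↥{z : EuclideanSpace ℝ (Fin 3) | z ∈ Set.range y ∧ z ≠ y i ∧ dist z (y i) < 13 / 10 * a₀},
        dist ((t : EuclideanSpace ℝ (Fin 3)) - y i)
          (A ((e t : ↥{p : EuclideanSpace ℝ (Fin 3) | p ∈ fccStacking a₀ h₀ ∧ p ≠ 0 ∧ ‖p‖ < 13 / 10 * a₀}) :
            EuclideanSpace ℝ (Fin 3))) ≤ τ))

set_option quotPrecheck false in
/-- `PC⟪δ, a₀, h₀, τ, κ⟫` — the pricing clause (the inner `∀ N y B` of the crux): every finite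
`δ`-separated configuration pays `κ` per `τ`-bad site above the bulk floor `N·e⋆` (SYNTAX ONLY). -/
scoped notation "PC⟪" δ ", " a₀ ", " h₀ ", " τ ", " κ "⟫" =>
  (∀ (N : ℕ) (y : Fin N → EuclideanSpace ℝ (Fin 3)), (∀ i j : Fin N, i ≠ j → δ ≤ dist (y i) (y j)) →
    ∀ B : Finset (Fin N), (∀ i ∈ B, ¬ Good⟪a₀, h₀, y, i, τ⟫) →
      κ * (B.card : ℝ) ≤ interactionEnergy lennardJones y - (N : ℝ) * eStar)

/-- **The crux IS `∀ δ > 0, ∃ cell in the box, ∀ τ ∈ (0,1], ∃ κ > 0, PC⟪δ, a₀, h₀, τ, κ⟫`**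
(syntactically, up to the name `eStar` of the infimum). [folklore] -/
theorem summedShellPricing_iff :
    SummedShellPricing ↔ ∀ δ : ℝ, 0 < δ → ∃ a₀ h₀ : ℝ, 47 / 50 ≤ a₀ ∧ a₀ ≤ 1 ∧
      |h₀ - a₀ * Real.sqrt (2 / 3)| ≤ a₀ / 100 ∧
      ∀ τ : ℝ, 0 < τ → τ ≤ 1 → ∃ κ : ℝ, 0 < κ ∧ PC⟪δ, a₀, h₀, τ, κ⟫ :=
  Iff.rfl

/-- Goodness is an up-set in the tolerance (same isometry, same bijection). [folklore] -/
theorem good_mono {a₀ h₀ : ℝ} {N : ℕ} {y : Fin N → E3} {i : Fin N} {τ τ' : ℝ} (hτ : τ ≤ τ')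
    (h : Good⟪a₀, h₀, y, i, τ⟫) : Good⟪a₀, h₀, y, i, τ'⟫ := by
  obtain ⟨A, ⟨e, he⟩ | ⟨e, he⟩⟩ := h
  · exact ⟨A, Or.inl ⟨e, fun t => (he t).trans hτ⟩⟩
  · exact ⟨A, Or.inr ⟨e, fun t => (he t).trans hτ⟩⟩

/-- The pricing clause is monotone in `τ`: a larger tolerance has fewer bad sites. [folklore] -/
theorem pricingClause_mono_tau {δ a₀ h₀ τ τ' κ : ℝ} (hτ : τ ≤ τ') (h : PC⟪δ, a₀, h₀, τ, κ⟫) :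
    PC⟪δ, a₀, h₀, τ', κ⟫ :=
  fun N y hsep B hB => h N y hsep B fun i hi hg => hB i hi (good_mono hτ hg)

/-- The pricing clause is antitone in `κ`. [folklore] -/
theorem pricingClause_mono_kappa {δ a₀ h₀ τ κ κ' : ℝ} (hκ : κ' ≤ κ) (h : PC⟪δ, a₀, h₀, τ, κ⟫) :
    PC⟪δ, a₀, h₀, τ, κ'⟫ :=
  fun N y hsep B hB => (mul_le_mul_of_nonneg_right hκ (Nat.cast_nonneg _)).trans (h N y hsep B hB)

/-- The pricing clause is monotone in `δ`: a larger separation admits fewer configurations. [folklore] -/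
theorem pricingClause_mono_delta {δ δ' a₀ h₀ τ κ : ℝ} (hδ : δ ≤ δ') (h : PC⟪δ, a₀, h₀, τ, κ⟫) :
    PC⟪δ', a₀, h₀, τ, κ⟫ :=
  fun N y hsep B hB => h N y (fun i j hij => hδ.trans (hsep i j hij)) B hB

/-! ## §1 Reference-shell facts and the sign of `e⋆` -/

/-- `ρ = max a₀ √(a₀²/3+h₀²) ≤ 1.01·a₀` on the box. [folklore] -/
theorem rho_le {a₀ h₀ : ℝ} (ha : 47 / 50 ≤ a₀) (hh : |h₀ - a₀ * Real.sqrt (2 / 3)| ≤ a₀ / 100) :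
    max a₀ (Real.sqrt (a₀ ^ 2 / 3 + h₀ ^ 2)) ≤ 101 / 100 * a₀ := by
  have ha0 : 0 < a₀ := by linarith
  have hs23 : Real.sqrt (2 / 3) < 817 / 1000 := by
    rw [show (817 : ℝ) / 1000 = Real.sqrt ((817 / 1000) ^ 2) by rw [Real.sqrt_sq (by norm_num)]]
    exact Real.sqrt_lt_sqrt (by norm_num) (by norm_num)
  have hs23' : (4 : ℝ) / 5 < Real.sqrt (2 / 3) := by
    rw [show (4 : ℝ) / 5 = Real.sqrt ((4 / 5) ^ 2) by rw [Real.sqrt_sq (by norm_num)]]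
    exact Real.sqrt_lt_sqrt (by norm_num) (by norm_num)
  have hhhi : h₀ ≤ 827 / 1000 * a₀ := by
    have h1 := (abs_le.1 hh).2
    have h2 := mul_lt_mul_of_pos_left hs23 ha0
    linarith only [h1, h2]
  have hhlo : 79 / 100 * a₀ ≤ h₀ := by
    have h1 := (abs_le.1 hh).1
    have h2 := mul_lt_mul_of_pos_left hs23' ha0
    linarith only [h1, h2]
  refine max_le (by linarith only [ha0]) ?_
  rw [show (101 : ℝ) / 100 * a₀ = Real.sqrt ((101 / 100 * a₀) ^ 2) by
    rw [Real.sqrt_sq (by positivity)]]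
  exact Real.sqrt_le_sqrt (by nlinarith only [hhhi, hhlo, ha0])

/-- Every point of either reference shell has norm `≤ ρ`. [folklore] -/
theorem norm_le_rho_of_mem {a₀ h₀ : ℝ} (ha : 47 / 50 ≤ a₀) (hh : |h₀ - a₀ * Real.sqrt (2 / 3)| ≤ a₀ / 100)
    {p : E3}
    (hp : p ∈ {p : E3 | p ∈ hcpStacking a₀ h₀ ∧ p ≠ 0 ∧ ‖p‖ < 13 / 10 * a₀} ∨
      p ∈ {p : E3 | p ∈ fccStacking a₀ h₀ ∧ p ≠ 0 ∧ ‖p‖ < 13 / 10 * a₀}) :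
    ‖p‖ ≤ max a₀ (Real.sqrt (a₀ ^ 2 / 3 + h₀ ^ 2)) := by
  rcases hp with ⟨hp, -, hpn⟩ | ⟨hp, -, hpn⟩
  · exact norm_le_of_mem_barlowStacking ha hh isHaggSeq_alternating hp hpn
  · exact norm_le_of_mem_barlowStacking ha hh isHaggSeq_const hp hpn

/-- Both reference shells contain a point of norm exactly `ρ` (the dilation lever). [folklore] -/
theorem exists_mem_norm_eq_rho {a₀ h₀ : ℝ} (ha : 47 / 50 ≤ a₀)
    (hh : |h₀ - a₀ * Real.sqrt (2 / 3)| ≤ a₀ / 100) {s : ℤ → ℤ} (hs : IsHaggSeq s) :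
    ∃ p ∈ {p : E3 | p ∈ barlowStacking a₀ h₀ s ∧ p ≠ 0 ∧ ‖p‖ < 13 / 10 * a₀},
      ‖p‖ = max a₀ (Real.sqrt (a₀ ^ 2 / 3 + h₀ ^ 2)) := by
  have ha0 : 0 < a₀ := by linarith
  have hρle := rho_le ha hh
  set b₀ : ℝ := Real.sqrt (a₀ ^ 2 / 3 + h₀ ^ 2) with hb₀
  rcases le_total b₀ a₀ with hab | hab
  · have hρeq : max a₀ b₀ = a₀ := max_eq_left hab
    refine ⟨barlowPos a₀ h₀ s 0 1 0, ⟨barlowPos_mem 0 1 0, ?_, ?_⟩, ?_⟩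
    · intro h0
      have h1 := norm_barlowPos_010 ha0.le h₀ s
      rw [h0, norm_zero] at h1
      linarith only [h1, ha0]
    · rw [norm_barlowPos_010 ha0.le h₀ s]; linarith only [ha0]
    · rw [norm_barlowPos_010 ha0.le h₀ s, hρeq]
  · have hρeq : max a₀ b₀ = b₀ := max_eq_right hab
    refine ⟨barlowPos a₀ h₀ s 1 0 0, ⟨barlowPos_mem 1 0 0, ?_, ?_⟩, ?_⟩
    · intro h0
      have h1 := norm_barlowPos_100 (a := a₀) (h := h₀) hs
      rw [h0, norm_zero] at h1
      have h2 : b₀ = 0 := by rw [hb₀]; exact h1.symm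
      linarith only [h2, hab, ha0]
    · rw [norm_barlowPos_100 hs, ← hb₀]
      have : max a₀ b₀ ≤ 101 / 100 * a₀ := hρle
      rw [hρeq] at this
      linarith only [this, ha0]
    · rw [norm_barlowPos_100 hs, ← hb₀, hρeq]

/-- Both reference shells contain the in-layer neighbour `(a₀, 0, 0)` of norm exactly `a₀`
(the two-cells lever). [folklore] -/
theorem exists_mem_norm_eq_a {a₀ h₀ : ℝ} (ha0 : 0 < a₀) (s : ℤ → ℤ) :
    ∃ p ∈ {p : E3 | p ∈ barlowStacking a₀ h₀ s ∧ p ≠ 0 ∧ ‖p‖ < 13 / 10 * a₀}, ‖p‖ = a₀ := by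
  refine ⟨barlowPos a₀ h₀ s 0 1 0, ⟨barlowPos_mem 0 1 0, ?_, ?_⟩, norm_barlowPos_010 ha0.le h₀ s⟩
  · intro h0
    have h1 := norm_barlowPos_010 ha0.le h₀ s
    rw [h0, norm_zero] at h1
    linarith only [h1, ha0]
  · rw [norm_barlowPos_010 ha0.le h₀ s]; linarith only [ha0]

/-- The energy of a two-point configuration. [folklore] -/
theorem interactionEnergy_two (V : ℝ → ℝ) (a b : E3) : interactionEnergy V ![a, b] = V (dist a b) := by
  unfold interactionEnergy
  have h0 : Finset.Ioi (0 : Fin 2) = {1} := by decide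
  have h1 : Finset.Ioi (1 : Fin 2) = ∅ := by decide
  simp [Fin.sum_univ_two, h0, h1]

/-- **`e⋆ ≤ −1/24 < 0`** (the dimer at distance `1` has energy `V_LJ(1) = −1/12`, and
`2 e⋆ ≤ E(2)`). [folklore] -/
theorem eStar_le_neg : eStar ≤ -(1 / 24) := by
  set b : E3 := barlowPos 1 0 constHagg 0 1 0 with hb
  have hdist : dist (0 : E3) b = 1 := by
    rw [dist_eq_norm, zero_sub, norm_neg, hb, norm_barlowPos_010 zero_le_one]
  have hinj : Function.Injective ![(0 : E3), b] := by
    intro i j hij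
    fin_cases i <;> fin_cases j
    · rfl
    · exfalso
      have h : (0 : E3) = b := hij
      have := hdist; rw [h, dist_self] at this; exact zero_ne_one this
    · exfalso
      have h : b = (0 : E3) := hij
      have := hdist; rw [h, dist_self] at this; exact zero_ne_one this
    · rfl
  have h1 := card_mul_eStar_le hinj
  rw [interactionEnergy_two, hdist, lennardJones_one] at h1
  norm_num at h1
  linarith

/-- `0 < −e⋆`. [folklore] -/
theorem neg_eStar_pos : 0 < -eStar := by linarith [eStar_le_neg]

/-! ## §2 Tightness: any admissible price is `O(τ²)` (dilated ground states)

The device of the 17253 refutation, run against the summed crux: a site of `x` that is `τ`-good at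
scale `1` is `τ`-BAD in the uniform dilate `(1+s)·x` once `s·ρ > 2τ` (take `s = 3τ/ρ`), because the
preimage of a reference point of maximal norm `ρ` is carried to norm `≥ (1+s)(ρ−τ) > ρ + τ`, out of
reach of every reference point; so EVERY site is `τ`-bad in `x` or in `(1+s)x`.  For a ground state
`x = x^N`: `𝓔(x) − N e⋆ = o(N)` (`crysEnergyLimit`) and `𝓔((1+s)x) − 𝓔(x) ≤ 36 s²·(−𝓔(x))`
(virial identity), `−𝓔(x)/N → −e⋆`.  Summing the clause over both configurations:
`κ N ≤ o(N) + 36 s² (−e⋆ + o(1)) N`, i.e. `κ ≤ 324 (−e⋆) τ²/ρ² ≤ 324 (−e⋆) (τ/a₀)²`. -/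

/-- **Dilation covering.** For `0 < τ ≤ 1/20`, a cell of the box and `s = 3τ/ρ`: a `τ`-good site of
`y` is `τ`-bad in `(1+s)•y`. [folklore] -/
theorem not_good_dilate_of_good {a₀ h₀ : ℝ} (ha : 47 / 50 ≤ a₀)
    (hh : |h₀ - a₀ * Real.sqrt (2 / 3)| ≤ a₀ / 100) {τ : ℝ} (hτ : 0 < τ) (hτ' : τ ≤ 1 / 20)
    {N : ℕ} (y : Fin N → E3) (i : Fin N) (hg : Good⟪a₀, h₀, y, i, τ⟫) :
    ¬ Good⟪a₀, h₀, (fun l => (1 + 3 * τ / max a₀ (Real.sqrt (a₀ ^ 2 / 3 + h₀ ^ 2))) • y l), i, τ⟫ := by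
  intro hg'
  have ha0 : 0 < a₀ := by linarith
  set ρ : ℝ := max a₀ (Real.sqrt (a₀ ^ 2 / 3 + h₀ ^ 2)) with hρ
  have hρa : a₀ ≤ ρ := le_max_left _ _
  have hρ0 : 0 < ρ := lt_of_lt_of_le ha0 hρa
  have hρle : ρ ≤ 101 / 100 * a₀ := rho_le ha hh
  set s : ℝ := 3 * τ / ρ with hs
  have hs0 : 0 ≤ s := by positivity
  have hfit : (1 + s) * (ρ + τ) < 13 / 10 * a₀ := by
    have hexp : (1 + s) * (ρ + τ) = ρ + 4 * τ + 3 * τ ^ 2 / ρ := by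
      rw [hs]; field_simp; ring
    have h3 : 3 * τ ^ 2 / ρ ≤ 1 / 100 := by
      rw [div_le_iff₀ hρ0]; nlinarith
    rw [hexp]; nlinarith
  have hF1 : ∀ p : E3, (p ∈ {p : E3 | p ∈ hcpStacking a₀ h₀ ∧ p ≠ 0 ∧ ‖p‖ < 13 / 10 * a₀} ∨
      p ∈ {p : E3 | p ∈ fccStacking a₀ h₀ ∧ p ≠ 0 ∧ ‖p‖ < 13 / 10 * a₀}) → ‖p‖ ≤ ρ :=
    fun p hp => norm_le_rho_of_mem ha hh hp
  have hdef : (1 + s) * (ρ - τ) - ρ ≤ τ := by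
    obtain ⟨A, ⟨e, he⟩ | ⟨e, he⟩⟩ := hg <;> obtain ⟨A', ⟨e', he'⟩ | ⟨e', he'⟩⟩ := hg'
    · exact dilation_defect y i _ _ (exists_mem_norm_eq_rho ha hh isHaggSeq_alternating)
        (fun p hp => hF1 p (Or.inl hp)) hs0 hfit A e he A' e' he'
    · exact dilation_defect y i _ _ (exists_mem_norm_eq_rho ha hh isHaggSeq_alternating)
        (fun p hp => hF1 p (Or.inr hp)) hs0 hfit A e he A' e' he'
    · exact dilation_defect y i _ _ (exists_mem_norm_eq_rho ha hh isHaggSeq_const)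
        (fun p hp => hF1 p (Or.inl hp)) hs0 hfit A e he A' e' he'
    · exact dilation_defect y i _ _ (exists_mem_norm_eq_rho ha hh isHaggSeq_const)
        (fun p hp => hF1 p (Or.inr hp)) hs0 hfit A e he A' e' he'
  have hexp : (1 + s) * (ρ - τ) - ρ = 2 * τ - 3 * τ ^ 2 / ρ := by
    rw [hs]; field_simp; ring
  have h3 : 3 * τ ^ 2 / ρ < τ := by
    rw [div_lt_iff₀ hρ0]; nlinarith
  linarith

/-- **TIGHTNESS of the crux: `κ(τ) ≤ 324·(−e⋆)·(τ/a₀)²` for `0 < τ ≤ 1/20`.**  If every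
Lennard-Jones ground state is `δ`-separated (true for the `δ` of `LennardJonesMinimalDistance_holds`,
and for every smaller `δ`), then at any cell of the box a price `κ` admissible in the pricing clause at
tolerance `τ` is at most `324 (−e⋆) (τ/a₀)²` (`≈ 250 τ²` at `e⋆ ≈ −0.7176`, `a₀ ≈ 0.971`; numerics of
the ideators put the true binding family — one displaced atom — at `1.4 τ²`).  Witness: the ground
states and their dilates by `1 + 3τ/ρ`. [folklore] -/
theorem kappa_le_of_pricingClause {δ : ℝ}
    (hδGS : ∀ (N : ℕ) (x : Fin N → E3), IsGroundState lennardJones x →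
      ∀ i j : Fin N, i ≠ j → δ ≤ dist (x i) (x j))
    {a₀ h₀ : ℝ} (ha : 47 / 50 ≤ a₀) (hh : |h₀ - a₀ * Real.sqrt (2 / 3)| ≤ a₀ / 100)
    {τ : ℝ} (hτ : 0 < τ) (hτ' : τ ≤ 1 / 20) {κ : ℝ} (hP : PC⟪δ, a₀, h₀, τ, κ⟫) :
    κ ≤ 324 * (-eStar) * (τ / a₀) ^ 2 := by
  classical
  by_contra hcon
  push Not at hcon
  have ha0 : 0 < a₀ := by linarith
  set ρ : ℝ := max a₀ (Real.sqrt (a₀ ^ 2 / 3 + h₀ ^ 2)) with hρ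
  have hρa : a₀ ≤ ρ := le_max_left _ _
  have hρ0 : 0 < ρ := lt_of_lt_of_le ha0 hρa
  set s : ℝ := 3 * τ / ρ with hs
  have hs0 : 0 < s := by positivity
  -- the constant `L = 324 (τ/a₀)² ≥ 36 s²`
  set L : ℝ := 324 * (τ / a₀) ^ 2 with hL
  have hL0 : 0 ≤ L := by positivity
  have hsL : 36 * s ^ 2 ≤ L := by
    have h1 : τ / ρ ≤ τ / a₀ := div_le_div_of_nonneg_left hτ.le ha0 hρa
    have h2 : 0 ≤ τ / ρ := by positivity
    have h3 : 36 * s ^ 2 = 324 * (τ / ρ) ^ 2 := by rw [hs]; ring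
    rw [h3, hL]
    nlinarith [mul_self_le_mul_self h2 h1]
  have hcon' : L * (-eStar) < κ := by rw [hL]; linarith
  -- the slack `θ`
  set θ : ℝ := (κ - L * (-eStar)) / (2 + L) with hθ
  have hθ0 : 0 < θ := div_pos (by linarith) (by linarith)
  have hθid : (2 + L) * θ = κ - L * (-eStar) := by
    rw [hθ]; field_simp
  -- a large `N`: `𝓔(N) < (e⋆ + θ) N` and `𝓔(N) > (e⋆ − θ) N`
  have hEL : Filter.Tendsto (fun N : ℕ => groundStateEnergy lennardJones 3 N / (N : ℝ)) Filter.atTop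
      (nhds eStar) := crysEnergyLimit
  have hev1 : ∀ᶠ N : ℕ in Filter.atTop, groundStateEnergy lennardJones 3 N / (N : ℝ) < eStar + θ :=
    (tendsto_order.1 hEL).2 _ (lt_add_of_pos_right _ hθ0)
  have hev2 : ∀ᶠ N : ℕ in Filter.atTop, eStar - θ < groundStateEnergy lennardJones 3 N / (N : ℝ) :=
    (tendsto_order.1 hEL).1 _ (by linarith)
  obtain ⟨N, hN1, hN2, hN3⟩ := (hev1.and (hev2.and (Filter.eventually_ge_atTop 1))).exists
  have hNpos : (0 : ℝ) < N := by exact_mod_cast hN3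
  have hEup : groundStateEnergy lennardJones 3 N < (eStar + θ) * N := (div_lt_iff₀ hNpos).1 hN1
  have hElo : (eStar - θ) * N < groundStateEnergy lennardJones 3 N := (lt_div_iff₀ hNpos).1 hN2
  have hE0 : 0 ≤ -groundStateEnergy lennardJones 3 N := by linarith [groundStateEnergy_nonpos N]
  -- the ground state and its dilate
  obtain ⟨x, hx⟩ := LennardJonesGroundStatesExist_holds N
  have hsep : ∀ i j : Fin N, i ≠ j → δ ≤ dist (x i) (x j) := hδGS N x hx
  have hs1 : (0 : ℝ) < 1 + s := by linarith
  set x' : Fin N → E3 := fun l => (1 + s) • x l with hx'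
  have hsep' : ∀ i j : Fin N, i ≠ j → δ ≤ dist (x' i) (x' j) := by
    intro i j hij
    have h1 := hsep i j hij
    show δ ≤ dist ((1 + s) • x i) ((1 + s) • x j)
    rw [dist_smul₀, Real.norm_eq_abs, abs_of_pos hs1]
    exact h1.trans (le_mul_of_one_le_left dist_nonneg (by linarith))
  -- the clause summed over both configurations
  set B₁ : Finset (Fin N) := Finset.univ.filter (fun i : Fin N => ¬ Good⟪a₀, h₀, x, i, τ⟫) with hB₁
  set B₂ : Finset (Fin N) := Finset.univ.filter (fun i : Fin N => ¬ Good⟪a₀, h₀, x', i, τ⟫) with hB₂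
  have hS1 := hP N x hsep B₁ (fun i hi => (Finset.mem_filter.1 hi).2)
  have hS2 := hP N x' hsep' B₂ (fun i hi => (Finset.mem_filter.1 hi).2)
  rw [hx.2] at hS1
  have hdil := interactionEnergy_dilate_le hx hs0.le
  rw [hx.2] at hdil
  have hdil' : interactionEnergy lennardJones x' - groundStateEnergy lennardJones 3 N
      ≤ 36 * s ^ 2 * (-groundStateEnergy lennardJones 3 N) := hdil
  -- every site is bad in `x` or in `x'`
  have hcover : (Finset.univ : Finset (Fin N)) ⊆ B₁ ∪ B₂ := by
    intro i _
    rw [Finset.mem_union, hB₁, hB₂, Finset.mem_filter, Finset.mem_filter]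
    by_cases hg : Good⟪a₀, h₀, x, i, τ⟫
    · exact Or.inr ⟨Finset.mem_univ _, not_good_dilate_of_good ha hh hτ hτ' x i hg⟩
    · exact Or.inl ⟨Finset.mem_univ _, hg⟩
  have hcount : (N : ℝ) ≤ (B₁.card : ℝ) + (B₂.card : ℝ) := by
    have h1 := (Finset.card_le_card hcover).trans (Finset.card_union_le _ _)
    rw [Finset.card_univ, Fintype.card_fin] at h1
    exact_mod_cast h1
  -- arithmetic (the big predicate is made opaque first: `linarith`'s atom comparison is up to defeq)
  clear_value x' B₁ B₂
  clear hcover hB₁ hB₂ hx' hP hdil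
  have hb1 : κ * (B₁.card : ℝ) < θ * N := by nlinarith [hS1, hEup]
  have h36 : 36 * s ^ 2 * (-groundStateEnergy lennardJones 3 N) ≤ L * ((θ - eStar) * N) := by
    calc 36 * s ^ 2 * (-groundStateEnergy lennardJones 3 N)
        ≤ L * (-groundStateEnergy lennardJones 3 N) := mul_le_mul_of_nonneg_right hsL hE0
      _ ≤ L * ((θ - eStar) * N) := mul_le_mul_of_nonneg_left (by linarith) hL0
  have hb2 : κ * (B₂.card : ℝ) < θ * N + L * ((θ - eStar) * N) := by
    have : interactionEnergy lennardJones x' - (N : ℝ) * eStar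
        ≤ groundStateEnergy lennardJones 3 N - (N : ℝ) * eStar
          + 36 * s ^ 2 * (-groundStateEnergy lennardJones 3 N) := by linarith
    nlinarith [hS2, this, h36, hEup]
  have hκ0 : 0 < κ := lt_of_le_of_lt (mul_nonneg hL0 neg_eStar_pos.le) hcon'
  have hsum : κ * (N : ℝ) < (2 * θ + L * (θ - eStar)) * N := by
    have := mul_le_mul_of_nonneg_left hcount hκ0.le
    nlinarith [this, hb1, hb2]
  have hfin : κ < 2 * θ + L * (θ - eStar) := lt_of_mul_lt_mul_right hsum hNpos.le
  nlinarith [hfin, hθid]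


end Summit.AtomisticToContinuum.Crystallization.Theorems.SummedShellPricing.Negative

end
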